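import Summits.HodgeConjecture.HodgeConjecture.Theorems.F0P3cStCharTSRankOneHyp           -- ★ p849196 (this seat): HYP `exists_mem_unitaryGroup_eigenframe_of_valued_det_lt`
import Literature.NumberTheory.Rogawski1990.StableClassesSplitTorus                       -- ★ `isConj_of_isStablyConj_of_splitFrame_two`
import Literature.NumberTheory.Rogawski1990.LocalNormFibreSurjectiveNonsplit             -- ★ `coe_localNonsplitEquiv_eq_map`
import Literature.NumberTheory.Rogawski1990.LocalNormFibreNonsplit                       -- ★ `IsLocalStablyConjH.snd_eq`
import Literature.NumberTheory.Rogawski1990.UnitFundamentalLemmaInertResiduallyRegular   -- ★ `isLocalStablyConjH_of_isConj_and_conj`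
import Literature.NumberTheory.Automorphic.UnitaryGroupInertPlaceHyperbolicBasis          -- ★ `galAdicCompletionMap_galAdicCompletionMap_of_smul_eq`
import HarnessLib

/-!
# F0 · P3c · line LH6 «StCharTS» — road (D) «DEEP-FL», brick D3-iv-a «ON THE STRATUM THE `H`-STABLE CLASS IS ONE CLASS»: for `γ_H` with `|det h₂|_w < |tr h₂|_w²`,
# `IsLocalStablyConjH γ_H δ ⇒ IsConj γ_H δ`, so `Φ^st(γ_H, f^H) = Φ([γ_H], f^H)`

Cell `pub/hodgecm-mathlib`, crux H413 = `stmt-HodgeConjecture-24833` (`--supports` lane, helper), route HCCMUnconditional; seat LH6-p04 (g2), road (D) owner;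
status v3 `F0/P3b/LH6-p04/g2/ROAD-D.status.v3.txt` brick D3-iv (ON-stratum matching), part (a) `H`-side.  THEOREMS ONLY, sorry-free.  HONEST LABEL: HC_CM is proved only
modulo the 7 printed citations (2 remaining: hLiu418 = stmt-HodgeConjecture-24832, h413 = stmt-HodgeConjecture-24833) until rung 0 closes; count-neutral.

THE MATHEMATICS («`𝔇(T∕F) = 1` for the split torus `T ≅ E^×` of `U(1,1)`», [Rogawski1990, §3.6 p. 31]).  ON the stratum, ★ HYP gives a unitary eigenframe
`h₂ Q = Q·diag(u₀, u₁)` over `L_w` with `σ(u₀) u₁ = 1`, `u₀ ≠ u₁` — a HYPERBOLIC pair, so `N(uᵢ) ≠ 1` (§1) and ★ `isConj_of_isStablyConj_of_splitFrame_two` makes every stably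
conjugate `δ₂` conjugate to `h₂` INSIDE `U(Φ₂)(L_w)`; transported through the one-place model ★ `localNonsplitEquiv` and joined with ★ `IsLocalStablyConjH.snd_eq` this is
`IsConj γ_H δ` in `H_v` (§2).  Hence the set of classes stably conjugate to `γ_H` is `{[γ_H]}` and the tree's ★ `stableOrbitalIntegralRel` collapses to one class orbital
integral (§3) — the `H`-side of D3-iv.

## References
* [Rogawski1990] J. D. Rogawski, *Automorphic Representations of Unitary Groups in Three Variables*, Ann. of Math. Stud. 123 (1990), §3.1 p. 19; §3.6 p. 31; §4.1 (4.1.1) p. 39.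
* [Kottwitz1986] R. Kottwitz, *Stable trace formula: elliptic singular terms*, Math. Ann. 275 (1986), §7.
* [PlatonovRapinchuk1994] V. Platonov, A. Rapinchuk, *Algebraic Groups and Number Theory* (1994), §5.1 (the one-place model).
-/

set_option autoImplicit false
-- the mandated namespace has the single-problem summit's repeated segment (`HodgeConjecture.HodgeConjecture`)
set_option linter.dupNamespace false

noncomputable section

open Matrix Polynomial NumberField IsDedekindDomain
open scoped MatrixGroups
open Literature.NumberTheory.Rogawski1990 Literature.NumberTheory.Automorphic Literature.NumberTheory.Automorphic.UnitaryGroup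
open Literature.NumberTheory.GaloisRepresentations
open Literature.AlgebraicGeometry.ShimuraVarieties (unitaryGroup)

namespace Summit.HodgeConjecture.HodgeConjecture.Cruxes.H413.F0P3cStCharTSOnStratumH

/-! ## §1 A hyperbolic eigenframe makes the stable class one class (model level, any field with involution) -/

section Model

variable {K : Type*} [Field K] (σ : K →+* K)

/-- `antidiag(1, 1)` is `σ`-hermitian. [folklore] -/
theorem antidiagTwo_map_transpose :
    ((Matrix.of fun i j : Fin 2 => if i.val + j.val + 1 = 2 then (1 : K) else 0).map σ)ᵀ =
      Matrix.of fun i j : Fin 2 => if i.val + j.val + 1 = 2 then (1 : K) else 0 := by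
  ext i j
  fin_cases i <;> fin_cases j <;> simp

/-- `det antidiag(1, 1)` is a unit. [folklore] -/
theorem isUnit_det_antidiagTwo : IsUnit (Matrix.of fun i j : Fin 2 => if i.val + j.val + 1 = 2 then (1 : K) else 0).det := by
  rw [Matrix.det_fin_two]
  simp

/-- **HYPERBOLIC FRAME ⇒ ONE CLASS.**  In `U(σ, antidiag(1,1))(K)` (`σ` an involution of the field `K`): if `γ` has an eigenframe `γ Q = Q·diag(u)` with `u₀ ≠ u₁` and
`σ(u₀)·u₁ = 1`, then every `δ` stably conjugate to `γ` is conjugate to `γ` (★ `isConj_of_isStablyConj_of_splitFrame_two`; the norms `σ(uᵢ)uᵢ − 1` are non-zero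
because the pair is hyperbolic). [cite: Rogawski1990, §3.6 p. 31] [cite: Kottwitz1986, §7] -/
theorem isConj_of_isStablyConj_of_hyperbolicFrame (hσ : ∀ r : K, σ (σ r) = r)
    {γ δ : unitaryGroup σ (Matrix.of fun i j : Fin 2 => if i.val + j.val + 1 = 2 then (1 : K) else 0)}
    (h : IsStablyConj σ (Matrix.of fun i j : Fin 2 => if i.val + j.val + 1 = 2 then (1 : K) else 0) γ δ)
    (Q : GL (Fin 2) K) {u : Fin 2 → K}
    (hQ : ((γ : GL (Fin 2) K) : Matrix (Fin 2) (Fin 2) K) * (Q : Matrix (Fin 2) (Fin 2) K) = (Q : Matrix (Fin 2) (Fin 2) K) * diagonal u)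
    (hu : Function.Injective u) (h01 : σ (u 0) * u 1 = 1) : IsConj γ δ := by
  have hσ0 : σ (u 0) ≠ 0 := fun h0 => by rw [h0, zero_mul] at h01; exact zero_ne_one h01
  have hu1 : u 1 ≠ 0 := fun h0 => by rw [h0, mul_zero] at h01; exact zero_ne_one h01
  have hne : u 0 ≠ u 1 := fun heq => absurd (hu heq) (by decide)
  refine isConj_of_isStablyConj_of_splitFrame_two σ _ hσ (antidiagTwo_map_transpose σ) (isUnit_det_antidiagTwo (K := K)) h Q hQ ?_ ?_
  · rw [isUnit_iff_ne_zero, sub_ne_zero]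
    intro h00
    apply hne
    exact mul_left_cancel₀ hσ0 (h00.trans h01.symm)
  · rw [isUnit_iff_ne_zero, sub_ne_zero]
    intro h11
    apply hne
    have : σ (u 1) = σ (u 0) := mul_right_cancel₀ hu1 (h11.trans h01.symm)
    have := congrArg σ this
    rwa [hσ, hσ, eq_comm] at this

end Model

/-! ## §2 On the CM carriers: `IsLocalStablyConjH γ_H δ` and `γ_H` ON the stratum ⇒ `IsConj γ_H δ` -/

section CM

variable (L : Type) [Field L] [NumberField L] [IsCMField L] (v : HeightOneSpectrum (𝓞 ↥(maximalRealSubfield L)))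
  (w : PlacesOver L v) (hw : IsCMField.complexConj L • w.1 = w.1)

omit [IsCMField L] in
/-- The local form of `Φ₂` at `w` is the literal `antidiag(1, 1)` over `L_w`. [cite: Rogawski1990, §3.5 p. 29] -/
theorem placeForm_antidiagTwo :
    placeForm (Matrix.of fun i j : Fin 2 => if i.val + j.val + 1 = 2 then (1 : L) else 0) w.1 =
      Matrix.of fun i j : Fin 2 => if i.val + j.val + 1 = 2 then (1 : w.1.adicCompletion L) else 0 := by
  ext i j
  simp only [placeForm, Matrix.map_apply, Matrix.of_apply]
  split_ifs <;> simp

include hw in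
set_option maxHeartbeats 800000 in  -- statement-level `whnf` on the CM carriers
/-- **D3-iv-a, element form.**  For `γ_H, δ ∈ H_v = U(Φ₂)_v × U(Φ₁)_v` at a non-split `v` (`w ∣ v`, `c • w = w`): if `γ_H` is ON the stratum (`|det h₂|_w < |tr h₂|_w²`)
and `δ` is stably conjugate to `γ_H` (★ `IsLocalStablyConjH`), then `δ` is CONJUGATE to `γ_H` in `H_v`. [cite: Rogawski1990, §3.1 p. 19; §3.6 p. 31] [cite: Kottwitz1986, §7] -/
theorem isConj_of_isLocalStablyConjH_of_on
    (γH δ : (cmDatum L 2 (Matrix.of fun i j : Fin 2 => if i.val + j.val + 1 = 2 then (1 : L) else 0)).Local v ×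
      (cmDatum L 1 (Matrix.of fun i j : Fin 1 => if i.val + j.val + 1 = 1 then (1 : L) else 0)).Local v)
    (hon : Valued.v ((Pi.evalRingHom (fun w' : PlacesOver L v => w'.1.adicCompletion L) w) ((γH.1.val : GL (Fin 2) (LocalRing L v)) : Matrix (Fin 2) (Fin 2) (LocalRing L v)).det) <
      Valued.v ((Pi.evalRingHom (fun w' : PlacesOver L v => w'.1.adicCompletion L) w) ((γH.1.val : GL (Fin 2) (LocalRing L v)) : Matrix (Fin 2) (Fin 2) (LocalRing L v)).trace) ^ 2)
    (hst : IsLocalStablyConjH L v γH δ) : IsConj γH δ := by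
  set ev := Pi.evalRingHom (fun w' : PlacesOver L v => w'.1.adicCompletion L) w with hev
  set σw := galAdicCompletionMap (L := L) (IsCMField.complexConj L) hw with hσw
  have hσσ : ∀ r, σw (σw r) = r := fun r => galAdicCompletionMap_galAdicCompletionMap_of_smul_eq (IsCMField.complexConj L) w (IsCMField.complexConj_ne_one L) hw r
  have hσv : ∀ x, Valued.v (σw x) = Valued.v x := fun x => valued_galAdicCompletionMap (L := L) (IsCMField.complexConj L) hw x
  set E₂ : (cmDatum L 2 (Matrix.of fun i j : Fin 2 => if i.val + j.val + 1 = 2 then (1 : L) else 0)).Local v ≃ₜ* ↥(unitaryGroupOfForm σw (placeForm (Matrix.of fun i j : Fin 2 => if i.val + j.val + 1 = 2 then (1 : L) else 0) w.1)) :=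
    localNonsplitEquiv (IsCMField.complexConj L) (Matrix.of fun i j : Fin 2 => if i.val + j.val + 1 = 2 then (1 : L) else 0) (IsCMField.complexConj_ne_one L) w hw with hE₂
  have hΦ := placeForm_antidiagTwo L v w
  -- the model elements `γ' = E₂ h₂`, `δ' = E₂ δ₂` inside the literal group `U(σ_w, antidiag(1,1))(L_w)`
  have hmem : ∀ g : (cmDatum L 2 (Matrix.of fun i j : Fin 2 => if i.val + j.val + 1 = 2 then (1 : L) else 0)).Local v,
      ((E₂ g : ↥(unitaryGroupOfForm σw (placeForm (Matrix.of fun i j : Fin 2 => if i.val + j.val + 1 = 2 then (1 : L) else 0) w.1))) : GL (Fin 2) (w.1.adicCompletion L)) ∈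
        unitaryGroup σw (Matrix.of fun i j : Fin 2 => if i.val + j.val + 1 = 2 then (1 : w.1.adicCompletion L) else 0) := by
    intro g
    have h2 := mem_unitaryGroupOfForm_iff.1 (E₂ g).2
    refine Literature.AlgebraicGeometry.ShimuraVarieties.mem_unitaryGroup_iff.2 ?_
    rw [← hΦ]
    exact h2
  set γ' : ↥(unitaryGroup σw (Matrix.of fun i j : Fin 2 => if i.val + j.val + 1 = 2 then (1 : w.1.adicCompletion L) else 0)) := ⟨_, hmem γH.1⟩ with hγ'
  set δ' : ↥(unitaryGroup σw (Matrix.of fun i j : Fin 2 => if i.val + j.val + 1 = 2 then (1 : w.1.adicCompletion L) else 0)) := ⟨_, hmem δ.1⟩ with hδ'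
  -- (1) stable conjugacy transported to the model: `GL₂(∏ L_w')`-conjugate ⇒ `GL₂(L_w)`-conjugate
  have hcoe : ∀ g : (cmDatum L 2 (Matrix.of fun i j : Fin 2 => if i.val + j.val + 1 = 2 then (1 : L) else 0)).Local v,
      Units.map (ev.mapMatrix : Matrix (Fin 2) (Fin 2) (LocalRing L v) →+* Matrix (Fin 2) (Fin 2) (w.1.adicCompletion L)).toMonoidHom
          (g.val : GL (Fin 2) (LocalRing L v)) =
        ((E₂ g : ↥(unitaryGroupOfForm σw (placeForm (Matrix.of fun i j : Fin 2 => if i.val + j.val + 1 = 2 then (1 : L) else 0) w.1))) : GL (Fin 2) (w.1.adicCompletion L)) := by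
    intro g
    apply Units.ext
    rw [Units.coe_map, RingHom.toMonoidHom_eq_coe, MonoidHom.coe_coe, RingHom.mapMatrix_apply]
    exact (coe_localNonsplitEquiv_eq_map L v w hw (N := 2) (H := Matrix.of fun i j : Fin 2 => if i.val + j.val + 1 = 2 then (1 : L) else 0) g).symm
  have hst' : IsStablyConj σw (Matrix.of fun i j : Fin 2 => if i.val + j.val + 1 = 2 then (1 : w.1.adicCompletion L) else 0) γ' δ' := by
    have h1 := MonoidHom.map_isConj (Units.map (ev.mapMatrix : Matrix (Fin 2) (Fin 2) (LocalRing L v) →+* Matrix (Fin 2) (Fin 2) (w.1.adicCompletion L)).toMonoidHom) hst.1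
    rw [hcoe, hcoe] at h1
    exact h1
  -- (2) the hyperbolic eigenframe of `γ'` from ★ HYP
  have hdet : (((γ' : GL (Fin 2) (w.1.adicCompletion L)) : Matrix (Fin 2) (Fin 2) (w.1.adicCompletion L))).det =
      ev ((γH.1.val : GL (Fin 2) (LocalRing L v)) : Matrix (Fin 2) (Fin 2) (LocalRing L v)).det := by
    change ((((γH.1.val : GL (Fin 2) (LocalRing L v)) : Matrix (Fin 2) (Fin 2) (LocalRing L v)).map ev)).det = _
    rw [← RingHom.mapMatrix_apply, ← RingHom.map_det]
  have htr : (((γ' : GL (Fin 2) (w.1.adicCompletion L)) : Matrix (Fin 2) (Fin 2) (w.1.adicCompletion L))).trace =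
      ev ((γH.1.val : GL (Fin 2) (LocalRing L v)) : Matrix (Fin 2) (Fin 2) (LocalRing L v)).trace := by
    change ((((γH.1.val : GL (Fin 2) (LocalRing L v)) : Matrix (Fin 2) (Fin 2) (LocalRing L v)).map ev)).trace = _
    rw [Matrix.trace, Matrix.trace, map_sum]
    rfl
  have hon' : Valued.v (((γ' : GL (Fin 2) (w.1.adicCompletion L)) : Matrix (Fin 2) (Fin 2) (w.1.adicCompletion L))).det <
      Valued.v (((γ' : GL (Fin 2) (w.1.adicCompletion L)) : Matrix (Fin 2) (Fin 2) (w.1.adicCompletion L))).trace ^ 2 := by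
    rw [hdet, htr]; exact hon
  obtain ⟨Q, u, -, hu, hQP, -, -, h01⟩ :=
    F0P3cStCharTSRankOneHyp.exists_mem_unitaryGroup_eigenframe_of_valued_det_lt w.1 σw hσσ hσv (γ'.2) hon'
  -- (3) one class in the model, transported back through `E₂`
  have hconj' : IsConj γ' δ' := isConj_of_isStablyConj_of_hyperbolicFrame σw hσσ hst' Q hQP hu h01
  obtain ⟨c, hc⟩ := isConj_iff.1 hconj'
  have hcmem : ((c : ↥(unitaryGroup σw (Matrix.of fun i j : Fin 2 => if i.val + j.val + 1 = 2 then (1 : w.1.adicCompletion L) else 0))) : GL (Fin 2) (w.1.adicCompletion L)) ∈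
      unitaryGroupOfForm σw (placeForm (Matrix.of fun i j : Fin 2 => if i.val + j.val + 1 = 2 then (1 : L) else 0) w.1) := by
    have h2 := Literature.AlgebraicGeometry.ShimuraVarieties.mem_unitaryGroup_iff.1 c.2
    refine mem_unitaryGroupOfForm_iff.2 ?_
    rw [hΦ]
    exact h2
  set c' : ↥(unitaryGroupOfForm σw (placeForm (Matrix.of fun i j : Fin 2 => if i.val + j.val + 1 = 2 then (1 : L) else 0) w.1)) := ⟨_, hcmem⟩ with hc'
  have hcE : c' * E₂ γH.1 * c'⁻¹ = E₂ δ.1 := by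
    apply Subtype.ext
    have := congrArg Subtype.val hc
    simpa [hc'] using this
  have hconj₁ : IsConj γH.1 δ.1 := by
    refine isConj_iff.2 ⟨E₂.symm c', E₂.injective ?_⟩
    rw [map_mul, map_mul, map_inv, ContinuousMulEquiv.apply_symm_apply]
    exact hcE
  -- (4) the `U(Φ₁)`-components agree
  have hsnd : γH.2 = δ.2 := hst.snd_eq
  obtain ⟨k, hk⟩ := isConj_iff.1 hconj₁
  exact isConj_iff.2 ⟨(k, 1), Prod.ext (by simpa using hk) (by simp [hsnd])⟩

/-! ## §3 `Φ^st(γ_H, f^H) = Φ([γ_H], f^H)` on the stratum -/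

include hw in
set_option maxHeartbeats 800000 in  -- statement-level `whnf` on the CM carriers
/-- **D3-iv-a, class-set form.**  ON the stratum the classes stably conjugate to `γ_H` are exactly `{[γ_H]}`. [cite: Rogawski1990, §3.1 p. 19; §3.6 p. 31] -/
theorem setOf_isLocalStablyConjH_out_eq_singleton_of_on
    (γH : (cmDatum L 2 (Matrix.of fun i j : Fin 2 => if i.val + j.val + 1 = 2 then (1 : L) else 0)).Local v ×
      (cmDatum L 1 (Matrix.of fun i j : Fin 1 => if i.val + j.val + 1 = 1 then (1 : L) else 0)).Local v)
    (hon : Valued.v ((Pi.evalRingHom (fun w' : PlacesOver L v => w'.1.adicCompletion L) w) ((γH.1.val : GL (Fin 2) (LocalRing L v)) : Matrix (Fin 2) (Fin 2) (LocalRing L v)).det) <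
      Valued.v ((Pi.evalRingHom (fun w' : PlacesOver L v => w'.1.adicCompletion L) w) ((γH.1.val : GL (Fin 2) (LocalRing L v)) : Matrix (Fin 2) (Fin 2) (LocalRing L v)).trace) ^ 2) :
    {c : ConjClasses ((cmDatum L 2 (Matrix.of fun i j : Fin 2 => if i.val + j.val + 1 = 2 then (1 : L) else 0)).Local v ×
        (cmDatum L 1 (Matrix.of fun i j : Fin 1 => if i.val + j.val + 1 = 1 then (1 : L) else 0)).Local v) | IsLocalStablyConjH L v γH (Quotient.out c)} =
      {ConjClasses.mk γH} := by
  ext c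
  simp only [Set.mem_setOf_eq, Set.mem_singleton_iff]
  constructor
  · intro hst
    have h1 : IsConj γH (Quotient.out c) := isConj_of_isLocalStablyConjH_of_on L v w hw γH (Quotient.out c) hon hst
    rw [← ConjClasses.mk_eq_mk_iff_isConj] at h1
    have h2 : ConjClasses.mk (Quotient.out c) = c := Quotient.out_eq c
    rw [h1, h2]
  · rintro rfl
    refine (isLocalStablyConjH_of_isConj_and_conj L γH).1 _ ?_
    have h2 : ConjClasses.mk (Quotient.out (ConjClasses.mk γH)) = ConjClasses.mk γH := Quotient.out_eq _
    exact (ConjClasses.mk_eq_mk_iff_isConj.1 h2).symm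

include hw in
set_option maxHeartbeats 800000 in  -- statement-level `whnf` on the CM carriers
/-- **D3-iv-a «Φ^st = Φ ON THE STRATUM».**  For every orbital measure family `mH` and every `f^H`: if `γ_H` is ON the stratum, then
`stableOrbitalIntegralRel (IsLocalStablyConjH L v) mH f^H γ_H = classOrbitalIntegral mH f^H [γ_H]`. [cite: Rogawski1990, §4.1 (4.1.1) p. 39; §3.6 p. 31] -/
theorem stableOrbitalIntegralRel_eq_classOrbitalIntegral_of_on
    [∀ aH : ((cmDatum L 2 (Matrix.of fun i j : Fin 2 => if i.val + j.val + 1 = 2 then (1 : L) else 0)).Local v ×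
        (cmDatum L 1 (Matrix.of fun i j : Fin 1 => if i.val + j.val + 1 = 1 then (1 : L) else 0)).Local v),
      MeasurableSpace (((cmDatum L 2 (Matrix.of fun i j : Fin 2 => if i.val + j.val + 1 = 2 then (1 : L) else 0)).Local v ×
          (cmDatum L 1 (Matrix.of fun i j : Fin 1 => if i.val + j.val + 1 = 1 then (1 : L) else 0)).Local v) ⧸
        Subgroup.centralizer ({aH} : Set ((cmDatum L 2 (Matrix.of fun i j : Fin 2 => if i.val + j.val + 1 = 2 then (1 : L) else 0)).Local v ×
          (cmDatum L 1 (Matrix.of fun i j : Fin 1 => if i.val + j.val + 1 = 1 then (1 : L) else 0)).Local v)))]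
    (mH : OrbitalMeasureFamily ((cmDatum L 2 (Matrix.of fun i j : Fin 2 => if i.val + j.val + 1 = 2 then (1 : L) else 0)).Local v ×
        (cmDatum L 1 (Matrix.of fun i j : Fin 1 => if i.val + j.val + 1 = 1 then (1 : L) else 0)).Local v))
    (fH : ((cmDatum L 2 (Matrix.of fun i j : Fin 2 => if i.val + j.val + 1 = 2 then (1 : L) else 0)).Local v ×
        (cmDatum L 1 (Matrix.of fun i j : Fin 1 => if i.val + j.val + 1 = 1 then (1 : L) else 0)).Local v) → ℂ)
    (γH : (cmDatum L 2 (Matrix.of fun i j : Fin 2 => if i.val + j.val + 1 = 2 then (1 : L) else 0)).Local v ×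
      (cmDatum L 1 (Matrix.of fun i j : Fin 1 => if i.val + j.val + 1 = 1 then (1 : L) else 0)).Local v)
    (hon : Valued.v ((Pi.evalRingHom (fun w' : PlacesOver L v => w'.1.adicCompletion L) w) ((γH.1.val : GL (Fin 2) (LocalRing L v)) : Matrix (Fin 2) (Fin 2) (LocalRing L v)).det) <
      Valued.v ((Pi.evalRingHom (fun w' : PlacesOver L v => w'.1.adicCompletion L) w) ((γH.1.val : GL (Fin 2) (LocalRing L v)) : Matrix (Fin 2) (Fin 2) (LocalRing L v)).trace) ^ 2) :
    stableOrbitalIntegralRel (IsLocalStablyConjH L v) mH fH γH = classOrbitalIntegral mH fH (ConjClasses.mk γH) := by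
  rw [stableOrbitalIntegralRel_def, setOf_isLocalStablyConjH_out_eq_singleton_of_on L v w hw γH hon, finsum_mem_singleton]

end CM

end Summit.HodgeConjecture.HodgeConjecture.Cruxes.H413.F0P3cStCharTSOnStratumH
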